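import Summits.AtomisticToContinuum.BoseEinsteinCondensation.Theses.BECFisherTransfer

/-!
# Route `BECFisherTransfer` — support item `PeriodicBecOfCoherence` (stmt-AtomisticToContinuum-14101)

Closes the support item stmt-AtomisticToContinuum-14101 (exact signature of
`Summit.AtomisticToContinuum.BoseEinsteinCondensation.Theses.BECFisherTransfer.PeriodicBecOfCoherence`):

  `HealingScaleCoherence → CoherencePropagation → PeriodicBec`.

The two length-axis halves of the route — `X_loc = HealingScaleCoherence` (¾-displacement-coherence of
every δ-near-minimiser of the periodic energy out to the scale `a(ρa³)^(-1/2-σ)` for SOME `σ > 0`) and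
`X_prop = CoherencePropagation` (for EVERY `σ > 0`, such near-field coherence of a δ-near-minimiser
forces `condensateOccupation ≥ N/2`) — give the shared target `PeriodicBec`
(stmt-AtomisticToContinuum-8997) with the explicit constant `c = 1/2`.

Proof (pure logic, the bookkeeping of the route's deciding theorem `closes` stopped one step before
`BoundaryTransferWeak`): fix an admissible `v`; `HealingScaleCoherence` gives `σ > 0` and `ρ₂ > 0`
with an eventual-in-`N` slack `δ₂`; `CoherencePropagation` at that `σ` gives `ρ₁ > 0` and an eventual
slack `δ₁`; for `0 < ρ < min ρ₁ ρ₂` take `c := 1/2` and, eventually in `N`, `δ := min δ₁ δ₂`: every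
`δ`-near-minimiser is a `δ₂`-near-minimiser, hence ¾-coherent, and a `δ₁`-near-minimiser, hence has
`condensateOccupation ≥ (1/2)·N`, which is the `PeriodicBec` clause [LSSY2005, Ch. 2 (periodic vs
Dirichlet BEC); PenroseOnsager1956].
-/

namespace Summit.AtomisticToContinuum.BoseEinsteinCondensation.Theorems

open Summit.AtomisticToContinuum.BoseEinsteinCondensation.Theses.BECFisherTransfer

/-- **`PeriodicBecOfCoherence`** (closes stmt-AtomisticToContinuum-14101, exact route signature):
`HealingScaleCoherence → CoherencePropagation → PeriodicBec` — local ¾-coherence beyond the healing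
scale for some `σ > 0` (X_loc) and its propagation to `condensateOccupation ≥ N/2` for every `σ > 0`
(X_prop) give constant-mode BEC for δ-near-minimisers of the periodic energy with `c = 1/2`, for
`ρ < min ρ₁ ρ₂` and `δ = min δ₁ δ₂` eventually in `N`. Pure logic. -/
theorem periodicBecOfCoherence_proof :
    Summit.AtomisticToContinuum.BoseEinsteinCondensation.Theses.BECFisherTransfer.PeriodicBecOfCoherence := by
  intro hLoc hProp v hv
  obtain ⟨σ, hσ, ρ₂, hρ₂, hA'⟩ := hLoc v hv
  obtain ⟨ρ₁, hρ₁, hP'⟩ := hProp v hv σ hσ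
  refine ⟨min ρ₁ ρ₂, lt_min hρ₁ hρ₂, fun ρ hρ hρlt => ?_⟩
  have h₁ := hP' ρ hρ (lt_of_lt_of_le hρlt (min_le_left _ _))
  have h₂ := hA' ρ hρ (lt_of_lt_of_le hρlt (min_le_right _ _))
  refine ⟨1 / 2, by norm_num, ?_⟩
  filter_upwards [h₁, h₂] with N hN₁ hN₂
  obtain ⟨δ₁, hδ₁, H₁⟩ := hN₁
  obtain ⟨δ₂, hδ₂, H₂⟩ := hN₂
  refine ⟨min δ₁ δ₂, lt_min hδ₁ hδ₂, fun Ψ hΨ => ?_⟩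
  exact H₁ Ψ (hΨ.trans <| by gcongr; exact min_le_left _ _)
    (H₂ Ψ (hΨ.trans <| by gcongr; exact min_le_right _ _))

end Summit.AtomisticToContinuum.BoseEinsteinCondensation.Theorems
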